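import Mathlib
import Literature.Analysis.PDE.InverseSquareChannelEstimate
import Literature.Analysis.ODE.InverseCoordSmooth
import Literature.Analysis.PDE.Wave1DFarComparisonLimits
import Literature.Analysis.PDE.FarChannelClaimLemmas
import Literature.Analysis.PDE.FarChannelClaimLemmas2
import Literature.Analysis.PDE.FarKernelSpanLemmas
import HarnessLib

/-!
# The far-side channel claim: approximating finite-energy far data by true kernel data

Analysis/PDE support file (everything proved). `far_channel_claim` (`n ≥ 1`): there are constants
`A, Θ` (depending on `n` and on the closeness constant `K_c` of the comparison family) such that
for every potential `P` of inverse-square type (`ε ≤ 1/64`), every comparison family `k_{α,β}`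
with the combination-level facts of `FarKernelCombos.lean`, and every global `C²` function `φ`
solving `φ_tt − φ_zz + Pφ = F` with `F = 0` on `{z ≥ 1}`, finite data energy `E_d` on `(1,∞)` and
exterior-energy limits `L⁺, L⁻`: for every `δ > 0` some `k_{α,β}` satisfies

  `∫_{z>1} e_P[φ − k_{α,β}](0) ≤ A (L⁺ + L⁻) + Θ ε² E_d + δ`.

Mechanism: the exact channel estimate (`InverseSquareChannelEstimate.lean`) for the data of `φ`,
the Duhamel comparison of the exact and true exterior energies
(`Wave1DFarComparisonLimits.lean`), the identification of the exact comparison data with kernel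
data and coefficient control (`FarChannelClaimLemmas.lean`), and the `ε`-closeness of the true
kernel data (`FarKernelCombos.lean`). Route PhotonSphereChannels, `FixedModeChannels`, far side
(stmt-FinalStateConjecture-10048). Folklore in method (Duyckaerts–Kenig–Merle channel arguments).
-/

noncomputable section

namespace Literature.Analysis.PDE

open MeasureTheory Set Filter Topology Finset Real Literature.Analysis.ODE
  Literature.Analysis.Calculus

/-- **The far-side channel claim.** See the module docstring. [folklore] -/
theorem far_channel_claim (n : ℕ) (hn : 1 ≤ n) {Kc : ℝ} (hKc : 0 ≤ Kc) :
    ∃ A Θ : ℝ, 0 ≤ A ∧ 0 ≤ Θ ∧ ∀ {P q : ℝ → ℝ} {ε : ℝ}, Continuous P → (∀ z, 0 ≤ P z) →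
      Continuous q → 0 ≤ ε → ε ≤ 1 / 64 →
      (∀ z, 3 / 8 ≤ z → P z = (n : ℝ) * (n + 1) / z ^ 2 + q z) →
      (∀ z, 3 / 8 ≤ z → |q z| ≤ ε * z ^ (-(5 : ℝ) / 2)) →
    ∀ (B : ℕ → ℕ → ℝ → ℝ → ℝ),
      (∀ α β : ℕ → ℝ,
        let k : ℝ → ℝ → ℝ := fun t z =>
          ∑ m ∈ range (n + 1), α m * B 0 m t z + ∑ m ∈ range n, β m * B 1 m t z
        ContDiff ℝ 2 (Function.uncurry k) ∧
        ((∀ m, Odd m → α m = 0) → (∀ m, Odd m → β m = 0) →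
          IntegrableOn (fun z =>
            (deriv (k 0) z - ∑ m ∈ range (n + 1), α m * ((m : ℝ) - n) * z ^ ((m : ℝ) - n - 1)) ^ 2
            + P z * (k 0 z - ∑ m ∈ range (n + 1), α m * z ^ ((m : ℝ) - n)) ^ 2
            + (deriv (fun τ => k τ z) 0 - ∑ m ∈ range n, β m * z ^ ((m : ℝ) - n)) ^ 2) (Ioi 1) ∧
          (∫ z in Ioi 1,
            ((deriv (k 0) z - ∑ m ∈ range (n + 1), α m * ((m : ℝ) - n) * z ^ ((m : ℝ) - n - 1)) ^ 2
            + P z * (k 0 z - ∑ m ∈ range (n + 1), α m * z ^ ((m : ℝ) - n)) ^ 2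
            + (deriv (fun τ => k τ z) 0 - ∑ m ∈ range n, β m * z ^ ((m : ℝ) - n)) ^ 2))
            ≤ Kc * ε ^ 2 * (∑ m ∈ range (n + 1), α m ^ 2 + ∑ m ∈ range n, β m ^ 2))) →
    ∀ (φ F : ℝ → ℝ → ℝ), ContDiff ℝ 2 (Function.uncurry φ) → Continuous (Function.uncurry F) →
      (∀ t z, iteratedDeriv 2 (fun τ => φ τ z) t - iteratedDeriv 2 (φ t) z + P z * φ t z = F t z) →
      (∀ τ z, 1 ≤ z → F τ z = 0) →
      (∫⁻ z in Ioi 1, ENNReal.ofReal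
        (deriv (fun τ => φ τ z) 0 ^ 2 + deriv (φ 0) z ^ 2 + P z * φ 0 z ^ 2)) < ⊤ →
    ∀ (Lp' Lm' : ℝ),
      Tendsto (fun t => ∫ z in Ioi (1 + |t|),
        (deriv (fun τ => φ τ z) t ^ 2 + deriv (φ t) z ^ 2 + P z * φ t z ^ 2)) atTop (𝓝 Lp') →
      Tendsto (fun t => ∫ z in Ioi (1 + |t|),
        (deriv (fun τ => φ τ z) t ^ 2 + deriv (φ t) z ^ 2 + P z * φ t z ^ 2)) atBot (𝓝 Lm') →
    ∀ δ : ℝ, 0 < δ → ∃ α β : ℕ → ℝ,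
      IntegrableOn (fun z =>
        deriv (fun τ => φ τ z - (∑ m ∈ range (n + 1), α m * B 0 m τ z
          + ∑ m ∈ range n, β m * B 1 m τ z)) 0 ^ 2
        + deriv (fun y => φ 0 y - (∑ m ∈ range (n + 1), α m * B 0 m 0 y
          + ∑ m ∈ range n, β m * B 1 m 0 y)) z ^ 2
        + P z * (φ 0 z - (∑ m ∈ range (n + 1), α m * B 0 m 0 z
          + ∑ m ∈ range n, β m * B 1 m 0 z)) ^ 2) (Ioi 1) ∧
      (∫ z in Ioi 1, (deriv (fun τ => φ τ z - (∑ m ∈ range (n + 1), α m * B 0 m τ z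
          + ∑ m ∈ range n, β m * B 1 m τ z)) 0 ^ 2
        + deriv (fun y => φ 0 y - (∑ m ∈ range (n + 1), α m * B 0 m 0 y
          + ∑ m ∈ range n, β m * B 1 m 0 y)) z ^ 2
        + P z * (φ 0 z - (∑ m ∈ range (n + 1), α m * B 0 m 0 z
          + ∑ m ∈ range n, β m * B 1 m 0 z)) ^ 2))
        ≤ A * (Lp' + Lm') + Θ * ε ^ 2 * (∫ z in Ioi 1,
            (deriv (fun τ => φ τ z) 0 ^ 2 + deriv (φ 0) z ^ 2 + P z * φ 0 z ^ 2)) + δ := by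
  -- constants
  obtain ⟨ι, hι, hιeq, -, I, hI, hI'⟩ := exists_smooth_inv_extension
  obtain ⟨c₃, hc₃, hV3⟩ := inverseSquare_channel_estimate hι hιeq hI hI' n
  obtain ⟨CK, hCK, hkap⟩ := far_kappa_facts hιeq hn
  set A₂ : ℝ := 4 / c₃ + 4 * Kc * CK / c₃ with hA₂
  have hA₂0 : 0 ≤ A₂ := by positivity
  refine ⟨16 / c₃ + 16 * Kc * CK / c₃, 256 / c₃ + 8 * Kc * CK + 256 * Kc * CK / c₃,
    by positivity, by positivity, ?_⟩
  intro P q ε hPc hP0 hq hε hε1 hPq hqb B hcombo φ F hφ hF hres hF0 hfin Lp' Lm' hLp' hLm' δ hδ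
  have hε1' : ε ≤ 1 := by linarith
  have hpot := fun z (hz : (1:ℝ) ≤ z) => far_potential_facts hn hε hε1' hιeq hPq hqb hz
  -- the exact potential
  set V₀ : ℝ → ℝ := fun x => (n : ℝ) * (n + 1) * ι x ^ 2 with hV₀
  have hV₀c : Continuous V₀ := continuous_const.mul (hι.continuous.pow 2)
  have hV₀0 : ∀ x, 0 ≤ V₀ x := fun x => by simp only [hV₀]; positivity
  -- data
  obtain ⟨hh, hg, i1, i2, i3, hint, heqE⟩ := far_data_facts hPc hP0 hφ hfin (W := V₀) hV₀c hV₀0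
    (fun z hz => by have := (hpot z hz.le).2.2.2.1; simp only [hV₀]; nlinarith [hP0 z])
  set Ed : ℝ := ∫ z in Ioi 1, (deriv (fun τ => φ τ z) 0 ^ 2 + deriv (φ 0) z ^ 2 + P z * φ 0 z ^ 2)
    with hEd
  have hEd0 : 0 ≤ Ed := setIntegral_nonneg measurableSet_Ioi fun z _ =>
    wave1D_energyDensity_nonneg hP0 0 z
  -- the exact comparison wave
  obtain ⟨φ₀, Lp, Lm, hφ₀C, hφ₀sol, hφ₀0, hφ₀1, hLp0, hLm0, hTp, hTm, hδV3⟩ :=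
    hV3 (φ 0) (fun x => deriv (fun τ => φ τ x) 0) hh hg i1 i2 i3
  obtain ⟨hF₀c, hF₀0⟩ := inverseSquare_residual (W := V₀) hV₀c hφ₀C hφ₀sol
  have hdata : ∀ x, φ₀ 0 x = φ 0 x ∧ deriv (fun τ => φ₀ τ x) 0 = deriv (fun τ => φ τ x) 0 :=
    fun x => ⟨hφ₀0 x, hφ₀1 x⟩
  have hqc : ∀ x, 1 ≤ x → (V₀ x - P x) ^ 2 ≤ ε ^ 2 * x ^ (-(2 * (3 / 2 : ℝ))) * P x :=
    fun x hx => (hpot x hx).2.2.1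
  have hVP : ∀ x, 1 ≤ x → V₀ x ≤ (1 + ε) * P x := fun x hx => (hpot x hx).2.2.2.1
  have hPV : ∀ x, 1 ≤ x → P x ≤ (1 + ε) * V₀ x := fun x hx => (hpot x hx).2.2.2.2.1
  -- comparison of the channel limits
  have hLpb : Lp ≤ 2 * (1 + ε) * Lp' + 8 * ε ^ 2 / (3 / 2 - 1) ^ 2 * Ed :=
    wave1D_far_limits_comparison hV₀c hV₀0 hPc hP0 hφ hF hres hF0 hφ₀C hF₀c (fun t x => rfl)
      (fun τ x hx => hF₀0 τ x hx) hdata hε (by norm_num) hε hqc hVP hfin hTp hLp'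
  have hLmb : Lm ≤ 2 * (1 + ε) * Lm' + 8 * ε ^ 2 / (3 / 2 - 1) ^ 2 * Ed :=
    wave1D_far_limits_comparison hV₀c hV₀0 hPc hP0 hφ hF hres hF0 hφ₀C hF₀c (fun t x => rfl)
      (fun τ x hx => hF₀0 τ x hx) hdata hε (by norm_num) hε hqc hVP hfin hTm hLm'
  have hL'0 : 0 ≤ Lp' + Lm' := by
    have h1 : 0 ≤ Lp' := ge_of_tendsto' hLp' fun t => setIntegral_nonneg measurableSet_Ioi
      fun z _ => wave1D_energyDensity_nonneg hP0 t z
    have h2 : 0 ≤ Lm' := ge_of_tendsto' hLm' fun t => setIntegral_nonneg measurableSet_Ioi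
      fun z _ => wave1D_energyDensity_nonneg hP0 t z
    linarith
  -- the exact comparison data at accuracy `δ₁`
  set δ₁ : ℝ := δ / (A₂ + 1) with hδ₁
  have hδ₁0 : 0 < δ₁ := by positivity
  obtain ⟨ch, cg, hX⟩ := hδV3 δ₁ hδ₁0
  obtain ⟨α, β, hαo, hβo, hα, hβ, hder, hcoef⟩ := hkap ch cg
  set L₁ : ℝ → ℝ := ladder ι n (fun z => ∑ m ∈ range (n + 1), ch m / m.factorial * (z - 1) ^ m)
    with hL₁
  set L₂ : ℝ → ℝ := ladder ι n (fun z => ∑ m ∈ range n, cg m / m.factorial * (z - 1) ^ m)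
    with hL₂
  have hpolyC : ∀ (c : ℕ → ℝ) (N : ℕ), ContDiff ℝ ((1 + n : ℕ) : ℕ∞)
      (fun z : ℝ => ∑ m ∈ range N, c m * (z - 1) ^ m) := fun c N =>
    ContDiff.sum fun m _ => contDiff_const.mul ((contDiff_id.sub contDiff_const).pow _)
  have hL₁C : ContDiff ℝ 1 L₁ := contDiff_ladder hι (hpolyC _ _)
  have hL₂C : ContDiff ℝ 1 L₂ := contDiff_ladder hι (hpolyC _ _)
  set S : ℝ := Lp + Lm + δ₁ with hS
  -- the combination and its closeness
  obtain ⟨hkC, hkcl⟩ := hcombo α β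
  obtain ⟨hJI, hJ⟩ := hkcl hαo hβo
  set k : ℝ → ℝ → ℝ := fun t z => ∑ m ∈ range (n + 1), α m * B 0 m t z
    + ∑ m ∈ range n, β m * B 1 m t z with hk
  obtain ⟨kt, -, -, -, -, hctk, -, -, -, -, hk1, -, -, -, -, -, -, -⟩ :=
    exists_partials_of_contDiff_two hkC
  have hk0c : Continuous (k 0) := (contDiff_two_slices'' hkC 0 0).2.continuous
  have hkzc : Continuous (deriv (k 0)) := (contDiff_two_slices'' hkC 0 0).2.continuous_deriv
    (by norm_num)
  have hktc : Continuous fun z => deriv (fun τ => k τ z) 0 := by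
    have : (fun z => deriv (fun τ => k τ z) 0) = fun z => kt 0 z := funext fun z => (hk1 0 z).deriv
    rw [this]; exact hctk.comp (continuous_const.prodMk continuous_id)
  -- the closeness integrand in ladder form on `Ioi 1`
  have hJeq : ∀ z ∈ Ioi (1:ℝ),
      (deriv (k 0) z - ∑ m ∈ range (n + 1), α m * ((m : ℝ) - n) * z ^ ((m : ℝ) - n - 1)) ^ 2
        + P z * (k 0 z - ∑ m ∈ range (n + 1), α m * z ^ ((m : ℝ) - n)) ^ 2
        + (deriv (fun τ => k τ z) 0 - ∑ m ∈ range n, β m * z ^ ((m : ℝ) - n)) ^ 2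
      = (deriv (k 0) z - deriv L₁ z) ^ 2 + P z * (k 0 z - L₁ z) ^ 2
        + (deriv (fun τ => k τ z) 0 - L₂ z) ^ 2 := by
    intro z hz
    have hz' : 1 / 2 < z := by have := Set.mem_Ioi.1 hz; linarith
    rw [hder z hz', hα z hz', hβ z hz']
  have hJI' := hJI.congr_fun hJeq measurableSet_Ioi
  have hJ' : (∫ z in Ioi 1, ((deriv (k 0) z - deriv L₁ z) ^ 2 + P z * (k 0 z - L₁ z) ^ 2
      + (deriv (fun τ => k τ z) 0 - L₂ z) ^ 2))
      ≤ Kc * ε ^ 2 * (∑ m ∈ range (n + 1), α m ^ 2 + ∑ m ∈ range n, β m ^ 2) := by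
    rw [← setIntegral_congr_fun measurableSet_Ioi hJeq]; exact hJ
  -- the comparison of the data energies
  obtain ⟨hEI, hEle⟩ := far_claim_compare (h := φ 0) (g := fun x => deriv (fun τ => φ τ x) 0)
    (L₁ := L₁) (L₂ := L₂) (k₀ := k 0) (kz := deriv (k 0)) (kt := fun z => deriv (fun τ => k τ z) 0)
    hPc hP0 hV₀c hV₀0 hε hc₃ hPV (hh.of_le (by norm_num)) hg.continuous hL₁C hL₂C.continuous
    hk0c hkzc hktc (S := S) (fun X hX1 => hX X hX1) hJI' hJ'
  -- the coefficient bound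
  have hco := far_claim_coeff (h := φ 0) (g := fun x => deriv (fun τ => φ τ x) 0) (L₁ := L₁)
    (L₂ := L₂) hP0 hV₀c hV₀0 hε hc₃ hVP (hh.of_le (by norm_num)) hg.continuous hL₁C hL₂C.continuous
    (S := S) (hX 2 (by norm_num)) hint (Ed := Ed) le_rfl
  have hcoef' : ∑ m ∈ range (n + 1), α m ^ 2 + ∑ m ∈ range n, β m ^ 2
      ≤ CK * (2 * ((1 + ε) * Ed) + 2 * (S / c₃)) := by
    refine hcoef.trans (mul_le_mul_of_nonneg_left (le_of_eq_of_le ?_ hco) hCK.le)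
    refine intervalIntegral.integral_congr fun x hx => ?_
    rw [uIcc_of_le (by norm_num : (1:ℝ) ≤ 2)] at hx
    have hx' : 1 / 2 < x := by linarith [hx.1]
    simp only [hV₀]
    rw [hder x hx', hα x hx', hβ x hx']
  -- identify the energy of `φ − k`
  have hdφ : ∀ z, DifferentiableAt ℝ (fun τ => φ τ z) 0 ∧ DifferentiableAt ℝ (φ 0) z := fun z =>
    ⟨(contDiff_two_slices'' hφ 0 z).1.differentiable (by norm_num) 0,
      (contDiff_two_slices'' hφ 0 z).2.differentiable (by norm_num) z⟩
  have hdk : ∀ z, DifferentiableAt ℝ (fun τ => k τ z) 0 ∧ DifferentiableAt ℝ (k 0) z := fun z =>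
    ⟨(contDiff_two_slices'' hkC 0 z).1.differentiable (by norm_num) 0,
      (contDiff_two_slices'' hkC 0 z).2.differentiable (by norm_num) z⟩
  have hEeq : (fun z => deriv (fun τ => φ τ z - k τ z) 0 ^ 2 + deriv (fun y => φ 0 y - k 0 y) z ^ 2
      + P z * (φ 0 z - k 0 z) ^ 2) = fun z => (deriv (fun τ => φ τ z) 0 - deriv (fun τ => k τ z) 0) ^ 2
        + (deriv (φ 0) z - deriv (k 0) z) ^ 2 + P z * (φ 0 z - k 0 z) ^ 2 := by
    funext z
    rw [deriv_fun_sub (hdφ z).1 (hdk z).1, deriv_fun_sub (hdφ z).2 (hdk z).2]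
  refine ⟨α, β, ?_, ?_⟩
  · show IntegrableOn (fun z => deriv (fun τ => φ τ z - k τ z) 0 ^ 2
      + deriv (fun y => φ 0 y - k 0 y) z ^ 2 + P z * (φ 0 z - k 0 z) ^ 2) (Ioi 1)
    rw [hEeq]; exact hEI
  · show (∫ z in Ioi 1, (deriv (fun τ => φ τ z - k τ z) 0 ^ 2
      + deriv (fun y => φ 0 y - k 0 y) z ^ 2 + P z * (φ 0 z - k 0 z) ^ 2)) ≤ _
    rw [hEeq]
    -- arithmetic
    have hSb : S ≤ 4 * (Lp' + Lm') + 64 * ε ^ 2 * Ed + δ₁ := by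
      have e : (8 : ℝ) * ε ^ 2 / (3 / 2 - 1) ^ 2 = 32 * ε ^ 2 := by ring
      rw [e] at hLpb hLmb
      have : 2 * (1 + ε) * (Lp' + Lm') ≤ 4 * (Lp' + Lm') := by nlinarith
      simp only [hS]; nlinarith
    have hS0 : 0 ≤ S := by simp only [hS]; linarith [hδ₁0.le]
    have hJc : Kc * ε ^ 2 * (∑ m ∈ range (n + 1), α m ^ 2 + ∑ m ∈ range n, β m ^ 2)
        ≤ Kc * ε ^ 2 * (CK * (2 * ((1 + ε) * Ed) + 2 * (S / c₃))) :=
      mul_le_mul_of_nonneg_left hcoef' (by positivity : (0:ℝ) ≤ Kc * ε ^ 2)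
    have hE := hEle.trans (add_le_add le_rfl (mul_le_mul_of_nonneg_left hJc
      (by norm_num : (0:ℝ) ≤ 2)))
    have hδ₁' : A₂ * δ₁ ≤ δ := by
      rw [hδ₁, mul_div_assoc', div_le_iff₀ (by positivity)]; nlinarith
    exact far_claim_arith hc₃ hKc hCK.le hε hε1' hEd0 hS0 hE hSb hδ₁'

end Literature.Analysis.PDE
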